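import Summits.Parity.GeneralizedHardyLittlewood.Theorems.GreenTaoLevelTwoGITwoCyclicInverseBSGPathsThree
import Summits.Parity.GeneralizedHardyLittlewood.Theorems.GreenTaoLevelTwoGITwoCyclicInverseBSGPopular
import Mathlib.Combinatorics.Additive.PluenneckeRuzsa

/-!
# Route `GreenTaoLevelTwo`, crux `GITwo` (stmt-Parity-21275), line `birth`, stub `stub_cyclicInverse`:
# the Balog–Szemerédi–Gowers theorem (polynomial form)

Eighth helper file toward the XL stub `stub_cyclicInverse` (B. Green, T. Tao, arXiv:math/0503014,
Thm. 68 = PEMS 51 (2008) Thm. 12.8).  It assembles the **Balog–Szemerédi–Gowers theorem**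
(arXiv Thm. 25, quoted there from Balog–Szemerédi 1994 / Gowers 1998 / Chang; "the precise values
of the constants are somewhat unimportant") from the sibling files `…BSGPopular` (popular sums carry
the energy), `…BSGPaths` / `…BSGPathsThreePrelims` / `…BSGPathsThree` (paths of length three) and
Mathlib's Ruzsa triangle inequality:

* `card_sextuples_ge` — for `(a,b)` joined by `L` paths of length three in the popular-sum graph,
  `a + b` has at least `L · (#A/2K)³` representations `(u₁+u₂) − (v₁+v₂) + (w₁+w₂)`, `uᵢ,vᵢ,wᵢ ∈ A`;
* `card_add_le_of_paths` — hence `#(A' + B') · L (#A/2K)³ ≤ #A⁶`;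
* `balog_szemeredi_gowers` — **BSG**: if `E(A) ≥ #A³/K` (`K ≥ 1`, Mathlib's `Finset.addEnergy`)
  then some `A' ⊆ A` has `#A' ≥ #A/(48K²)` and `#(A' − A') ≤ 2⁵⁷K²¹ #A'`.

This is the form used in arXiv Prop. 27 (with Plünnecke–Ruzsa, Mathlib, for the iterated sum-difference
sets); the constants are far from Chang's `2⁴²K⁶` but polynomial, which is all the line needs.

References: [GreenTao2008U3Inverse] arXiv:math/0503014 Thm. 25; A. Balog, E. Szemerédi,
Combinatorica 14 (1994); W. T. Gowers, GAFA 8 (1998) Prop. 12; T. Tao, V. Vu, *Additive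
Combinatorics*, Thm. 2.29.
-/

namespace Summit.Parity.GeneralizedHardyLittlewood.GreenTaoLevelTwoGITwoCyclicInverse

open Finset
open scoped Pointwise Combinatorics.Additive

variable {G : Type*} [AddCommGroup G] [DecidableEq G]

/-- **Sextuple count.** Let `P ⊆ G` be a set of sums each having at least `r₀ ≥ 0` representations in
`A + A`, and let `E = {(a,b) ∈ A² : a + b ∈ P}`.  If `(a, b)` is joined by the paths
`{(b₁,a₁) ∈ A² : a+b₁, a₁+b₁, a₁+b ∈ P}` of cardinality `≥ L`, then
`#{(u,v,w) ∈ (A²)³ : (u₁+u₂) − (v₁+v₂) + (w₁+w₂) = a + b} ≥ L · r₀³`.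
[cite: GreenTao2008U3Inverse, Thm. 25 (proof: the counting step)] -/
theorem card_sextuples_ge (A : Finset G) (P : Finset G) {r₀ : ℝ} (hr₀ : 0 ≤ r₀)
    (hP : ∀ y ∈ P, r₀ ≤ #{p ∈ A ×ˢ A | p.1 + p.2 = y}) (a b : G) {L : ℝ}
    (hL : L ≤ #{q ∈ A ×ˢ A | a + q.1 ∈ P ∧ q.2 + q.1 ∈ P ∧ q.2 + b ∈ P}) :
    L * r₀ ^ 3 ≤ #{s ∈ (A ×ˢ A) ×ˢ ((A ×ˢ A) ×ˢ (A ×ˢ A)) |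
      (s.1.1 + s.1.2) - (s.2.1.1 + s.2.1.2) + (s.2.2.1 + s.2.2.2) = a + b} := by
  set Pa : Finset (G × G) := {q ∈ A ×ˢ A | a + q.1 ∈ P ∧ q.2 + q.1 ∈ P ∧ q.2 + b ∈ P} with hPa
  set Rep : G → Finset (G × G) := fun y => {p ∈ A ×ˢ A | p.1 + p.2 = y} with hRep
  set S : Finset ((G × G) × ((G × G) × (G × G))) := {s ∈ (A ×ˢ A) ×ˢ ((A ×ˢ A) ×ˢ (A ×ˢ A)) |
      (s.1.1 + s.1.2) - (s.2.1.1 + s.2.1.2) + (s.2.2.1 + s.2.2.2) = a + b} with hS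
  -- the parametrising set: a path and representations of its three popular sums
  set D := Pa.sigma (fun q => Rep (a + q.1) ×ˢ (Rep (q.2 + q.1) ×ˢ Rep (q.2 + b))) with hD
  have hDcard : (#D : ℝ) = ∑ q ∈ Pa, (#(Rep (a + q.1)) : ℝ) * (#(Rep (q.2 + q.1)) * #(Rep (q.2 + b))) := by
    rw [hD, card_sigma]; push_cast
    refine sum_congr rfl fun q _ => ?_
    rw [card_product, card_product]; push_cast; ring
  have hDge : L * r₀ ^ 3 ≤ #D := by
    rw [hDcard]
    have h1 : ∀ q ∈ Pa, r₀ ^ 3 ≤ (#(Rep (a + q.1)) : ℝ) * (#(Rep (q.2 + q.1)) * #(Rep (q.2 + b))) := by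
      intro q hq
      rw [hPa, mem_filter] at hq
      obtain ⟨-, h1, h2, h3⟩ := hq
      calc r₀ ^ 3 = r₀ * (r₀ * r₀) := by ring
        _ ≤ _ := by
          apply mul_le_mul (hP _ h1) (mul_le_mul (hP _ h2) (hP _ h3) hr₀ (Nat.cast_nonneg _))
            (mul_nonneg hr₀ hr₀) (Nat.cast_nonneg _)
    calc L * r₀ ^ 3 ≤ #Pa * r₀ ^ 3 := mul_le_mul_of_nonneg_right hL (pow_nonneg hr₀ 3)
      _ = ∑ _q ∈ Pa, r₀ ^ 3 := by rw [sum_const, nsmul_eq_mul]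
      _ ≤ _ := sum_le_sum h1
  -- the injection `D → S`
  have hinj : #D ≤ #S := by
    refine Finset.card_le_card_of_injOn (fun d => d.2) ?_ ?_
    · intro d hd
      rw [mem_coe, hD, mem_sigma] at hd
      obtain ⟨-, ht⟩ := hd
      simp only [hRep, mem_filter, mem_product] at ht
      obtain ⟨⟨hu, eu⟩, ⟨hv, ev⟩, ⟨hw, ew⟩⟩ := ht
      show d.2 ∈ S
      rw [hS]
      simp only [mem_filter, mem_product]
      refine ⟨⟨hu, hv, hw⟩, ?_⟩
      rw [eu, ev, ew]
      abel
    · intro d hd d' hd' h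
      rw [mem_coe, hD, mem_sigma] at hd hd'
      simp only [hRep, mem_filter, mem_product] at hd hd'
      have h2 : d.2 = d'.2 := h
      have hq1 : d.1.1 = d'.1.1 := by
        have e1 := hd.2.1.2
        have e2 := hd'.2.1.2
        rw [h2] at e1
        exact add_left_cancel (e1.symm.trans e2)
      have hq2 : d.1.2 = d'.1.2 := by
        have e1 := hd.2.2.2.2
        have e2 := hd'.2.2.2.2
        rw [h2] at e1
        exact add_right_cancel (e1.symm.trans e2)
      have hq : d.1 = d'.1 := Prod.ext hq1 hq2
      exact Sigma.ext hq (heq_of_eq h2)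
  calc L * r₀ ^ 3 ≤ #D := hDge
    _ ≤ #S := by exact_mod_cast hinj

/-- **Sumset bound from paths.** If every `(a,b) ∈ A' × B'` (`A', B' ⊆ A`) has at least `L ≥ 0`
paths of length three in the popular-sum graph (popularity threshold `r₀ ≥ 0`), then
`#(A' + B') · L · r₀³ ≤ (#A)⁶`. [cite: GreenTao2008U3Inverse, Thm. 25 (proof: the counting step)] -/
theorem card_add_mul_le_of_paths (A : Finset G) (P : Finset G) {r₀ : ℝ} (hr₀ : 0 ≤ r₀)
    (hP : ∀ y ∈ P, r₀ ≤ #{p ∈ A ×ˢ A | p.1 + p.2 = y}) (A' B' : Finset G) {L : ℝ}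
    (hL : ∀ a ∈ A', ∀ b ∈ B',
      L ≤ #{q ∈ A ×ˢ A | a + q.1 ∈ P ∧ q.2 + q.1 ∈ P ∧ q.2 + b ∈ P}) :
    (#(A' + B') : ℝ) * (L * r₀ ^ 3) ≤ (#A : ℝ) ^ 6 := by
  set U : Finset ((G × G) × ((G × G) × (G × G))) := (A ×ˢ A) ×ˢ ((A ×ˢ A) ×ˢ (A ×ˢ A)) with hU
  set σ : (G × G) × ((G × G) × (G × G)) → G :=
    fun s => (s.1.1 + s.1.2) - (s.2.1.1 + s.2.1.2) + (s.2.2.1 + s.2.2.2) with hσ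
  have hx : ∀ x ∈ A' + B', L * r₀ ^ 3 ≤ (#{s ∈ U | σ s = x} : ℝ) := by
    intro x hx
    obtain ⟨a, ha, b, hb, rfl⟩ := mem_add.mp hx
    exact card_sextuples_ge A P hr₀ hP a b (hL a ha b hb)
  have hsum : ∑ x ∈ A' + B', (#{s ∈ U | σ s = x} : ℝ) ≤ (#U : ℝ) := by
    have h := sum_card_fiberwise_eq_card_filter U (A' + B') σ
    have h2 : #{s ∈ U | σ s ∈ A' + B'} ≤ #U := card_le_card (filter_subset _ U)
    exact_mod_cast h.le.trans h2
  have hUcard : (#U : ℝ) = (#A : ℝ) ^ 6 := by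
    simp only [hU, card_product]; push_cast; ring
  calc (#(A' + B') : ℝ) * (L * r₀ ^ 3) = ∑ _x ∈ A' + B', L * r₀ ^ 3 := by
        rw [sum_const, nsmul_eq_mul]
    _ ≤ ∑ x ∈ A' + B', (#{s ∈ U | σ s = x} : ℝ) := sum_le_sum hx
    _ ≤ #U := hsum
    _ = (#A : ℝ) ^ 6 := hUcard

/-- **The Balog–Szemerédi–Gowers theorem** (polynomial form). If a nonempty finite subset `A` of an
additive commutative group has additive energy `E(A) ≥ (#A)³/K` with `K ≥ 1`, then some `A' ⊆ A`
has `#A' ≥ #A/(48K²)` and `#(A' − A') ≤ 2⁵⁷K²¹ · #A'`.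
[cite: GreenTao2008U3Inverse, Thm. 25] -/
theorem balog_szemeredi_gowers (A : Finset G) (hA : A.Nonempty) {K : ℝ} (hK : 1 ≤ K)
    (hE : (#A : ℝ) ^ 3 / K ≤ (E[A, A] : ℝ)) :
    ∃ A' ⊆ A, (#A : ℝ) / (48 * K ^ 2) ≤ #A' ∧ (#(A' - A') : ℝ) ≤ 2 ^ 57 * K ^ 21 * #A' := by
  have hK0 : 0 < K := lt_of_lt_of_le one_pos hK
  have hApos : (0 : ℝ) < #A := by exact_mod_cast hA.card_pos
  -- the popular-sum graph
  obtain ⟨P, hP⟩ : ∃ P : Finset G, P = (A + A).filter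
      (fun x => (#A : ℝ) / (2 * K) ≤ ((#{q ∈ A ×ˢ A | q.1 + q.2 = x} : ℕ) : ℝ)) := ⟨_, rfl⟩
  obtain ⟨E, hEdef⟩ : ∃ E : Finset (G × G), E = {p ∈ A ×ˢ A | p.1 + p.2 ∈ P} := ⟨_, rfl⟩
  have hEcard : (#A : ℝ) * #A / (2 * K) ≤ #E := by
    have h := card_popularEdges_ge A hK0 hE
    rw [← hP, ← hEdef] at h
    rw [show (#A : ℝ) * #A = (#A : ℝ) ^ 2 by ring]
    exact h
  have hEA : ∀ e ∈ E, e.1 ∈ A := fun e he => by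
    rw [hEdef, mem_filter, mem_product] at he; exact he.1.1
  have hEB : ∀ e ∈ E, e.2 ∈ A := fun e he => by
    rw [hEdef, mem_filter, mem_product] at he; exact he.1.2
  have hpop : ∀ y ∈ P, (#A : ℝ) / (2 * K) ≤ #{p ∈ A ×ˢ A | p.1 + p.2 = y} := fun y hy => by
    rw [hP, mem_filter] at hy; exact hy.2
  -- paths of length three with constant `2K`
  have h2K : (1 : ℝ) ≤ 2 * K := by linarith
  obtain ⟨A', hA'A, B', hB'A, hA'card, hB'card, hpaths⟩ :=
    exists_paths_of_length_three A A E hEA hEB hA hA h2K hEcard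
  -- membership in `E` versus popularity of the sum
  have hmemE : ∀ u v : G, u ∈ A → v ∈ A → ((u, v) ∈ E ↔ u + v ∈ P) := by
    intro u v hu hv
    rw [hEdef, mem_filter, mem_product]
    exact ⟨fun h => h.2, fun h => ⟨⟨hu, hv⟩, h⟩⟩
  have hL : ∀ a ∈ A', ∀ b ∈ B', (#A : ℝ) * #A / (2 ^ 15 * (2 * K) ^ 6) ≤
      #{q ∈ A ×ˢ A | a + q.1 ∈ P ∧ q.2 + q.1 ∈ P ∧ q.2 + b ∈ P} := by
    intro a ha b hb
    refine (hpaths a ha b hb).trans (le_of_eq ?_)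
    congr 2
    refine filter_congr fun q hq => ?_
    rw [mem_product] at hq
    rw [hmemE a q.1 (hA'A ha) hq.1, hmemE q.2 q.1 hq.2 hq.1, hmemE q.2 b hq.2 (hB'A hb)]
  -- the sumset bound
  have hsum := card_add_mul_le_of_paths A P (by positivity : (0 : ℝ) ≤ #A / (2 * K)) hpop A' B' hL
  have hA'pos : (0 : ℝ) < #A' := lt_of_lt_of_le (by positivity) hA'card
  have hB'pos : (0 : ℝ) < #B' := lt_of_lt_of_le (by positivity) hB'card
  -- `#(A'+B') ≤ 2^24 K^9 #A`
  have hAB : (#(A' + B') : ℝ) ≤ 2 ^ 24 * K ^ 9 * #A := by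
    have hM : (#A : ℝ) * #A / (2 ^ 15 * (2 * K) ^ 6) * (#A / (2 * K)) ^ 3 =
        (#A : ℝ) ^ 5 / (2 ^ 24 * K ^ 9) := by
      field_simp
    rw [hM] at hsum
    have h6 : (#A : ℝ) ^ 6 = 2 ^ 24 * K ^ 9 * #A * ((#A : ℝ) ^ 5 / (2 ^ 24 * K ^ 9)) := by
      field_simp
    rw [h6] at hsum
    exact le_of_mul_le_mul_right hsum (by positivity)
  -- Ruzsa's triangle inequality
  have hruzsa : (#(A' - A') : ℝ) * #B' ≤ (#(A' + B') : ℝ) * #(A' + B') := by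
    exact_mod_cast Finset.ruzsa_triangle_inequality_sub_add_add A' B' A'
  refine ⟨A', hA'A, ?_, ?_⟩
  · have : (#A : ℝ) / (12 * (2 * K) ^ 2) = #A / (48 * K ^ 2) := by ring
    rw [← this]; exact hA'card
  · -- `#(A'-A') ≤ #(A'+B')²/#B' ≤ (2^24 K^9 #A)² · 8K/#A = 2^51 K^19 #A ≤ 2^51·48 K^21 #A'`
    have h1 : (#(A' - A') : ℝ) * #B' ≤ (2 ^ 24 * K ^ 9 * #A) ^ 2 := by
      calc (#(A' - A') : ℝ) * #B' ≤ (#(A' + B') : ℝ) * #(A' + B') := hruzsa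
        _ = (#(A' + B') : ℝ) ^ 2 := by ring
        _ ≤ (2 ^ 24 * K ^ 9 * #A) ^ 2 := by
            exact pow_le_pow_left₀ (Nat.cast_nonneg _) hAB 2
    have hB'card' : (#A : ℝ) / (8 * K) ≤ #B' := by
      have : (#A : ℝ) / (4 * (2 * K)) = #A / (8 * K) := by ring
      rw [← this]; exact hB'card
    have hA'card' : (#A : ℝ) ≤ 48 * K ^ 2 * #A' := by
      have h := hA'card
      rw [div_le_iff₀ (by positivity)] at h
      have : (#A : ℝ) / (12 * (2 * K) ^ 2) * (12 * (2 * K) ^ 2) = #A := by field_simp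
      linarith [h, this]
    -- from `h1` and `hB'card'`: `#(A'-A') · #A/(8K) ≤ 2^48 K^18 #A²`
    have h2 : (#(A' - A') : ℝ) * (#A / (8 * K)) ≤ (2 ^ 24 * K ^ 9 * #A) ^ 2 :=
      le_trans (mul_le_mul_of_nonneg_left hB'card' (Nat.cast_nonneg _)) h1
    have h3 : (#(A' - A') : ℝ) ≤ 2 ^ 51 * K ^ 19 * #A := by
      rw [mul_div_assoc'] at h2
      rw [div_le_iff₀ (by positivity)] at h2
      -- h2 : #(A'-A') * #A ≤ (2^24 K^9 #A)^2 * (8K)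
      have h4 : (#(A' - A') : ℝ) * #A ≤ (2 ^ 51 * K ^ 19 * #A) * #A := by
        calc (#(A' - A') : ℝ) * #A ≤ (2 ^ 24 * K ^ 9 * #A) ^ 2 * (8 * K) := h2
          _ = (2 ^ 51 * K ^ 19 * #A) * #A := by ring
      exact le_of_mul_le_mul_right h4 hApos
    calc (#(A' - A') : ℝ) ≤ 2 ^ 51 * K ^ 19 * #A := h3
      _ ≤ 2 ^ 51 * K ^ 19 * (48 * K ^ 2 * #A') := by gcongr
      _ = (2 ^ 51 * 48) * K ^ 21 * #A' := by ring
      _ ≤ 2 ^ 57 * K ^ 21 * #A' := by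
          have : (0 : ℝ) ≤ K ^ 21 * #A' := by positivity
          nlinarith [this]

end Summit.Parity.GeneralizedHardyLittlewood.GreenTaoLevelTwoGITwoCyclicInverse
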